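import Summits.HodgeConjecture.HodgeConjecture.Theorems.F0P3cStCharTSMovingRoot    -- ★ `exists_continuousAt_root`, `eventually_forall_norm_coeff_sub_lt`
import Summits.HodgeConjecture.HodgeConjecture.Theorems.F0P3cStCharTSRootCount     -- ★ `exists_pos_separating`, `exists_pos_le_of_finset`
import HarnessLib

/-!
# F0 · P3c · line LH6 «StCharTS» — «MOVING-ROOT-SYSTEM★»: near a monic polynomial with SIMPLE rational roots, ALL rational roots move continuously,
# in pairwise disjoint windows, and eventually the rational roots of `f y` are EXACTLY the moved old roots (proper normed field)

Cell `pub/hodgecm-mathlib`, crux H413 = `stmt-HodgeConjecture-24833` (lane `--supports … --as helper`), route HCCMUnconditional; seat LH4-p03 (g7).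
THEOREMS ONLY over ★ `…Theorems.F0P3cStCharTSMovingRoot` (P5) + ★ `…Theorems.F0P3cStCharTSRootCount` (P4) (hence ★ RootPersist, ★ RootCalculus, Mathlib);
no definition ∕ instance ∕ notation ∕ named fact ∕ `sorry`.
Consumer (datum road MAP-DATUM-ROAD v4, slice S13b «UPR-LC» road (I)(γ), F0P3-p02 (g20)): at `Y := U(Φ₃)(L⁺_v)`, `f y := charpoly y` (monic of degree 3,
coefficients continuous), `x₀` regular so `charpoly x₀` has simple roots: the matched `H`-classes of `y` near `x₀` are indexed by the norm-one roots of
`charpoly y`, and THIS file says those roots are `{u a y : a ∈ roots (charpoly x₀)}` with `a ↦ u a y` injective and each `u a` continuous at `x₀` —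
the bookkeeping «injective + exhaustive» of (γ) at the level of roots.

THE MATHEMATICS (`K` a PROPER normed field; `Y` a topological space, `y₀ ∈ Y`; `f : Y → K[X]` monic of constant degree near `y₀` with coefficients
continuous at `y₀`; every `K`-root of `f y₀` simple).
* `exists_continuousAt_roots`: a window `δ > 0` separating the roots of `f y₀` (`a ≠ b ⇒ 2δ ≤ ‖a − b‖`) and maps `u a : Y → K` (`a ∈ roots (f y₀)`) with
  `u a y₀ = a`, `u a` continuous at `y₀`, and for all `y` near `y₀`: each `u a y` is a root of `f y` within `δ` of `a`; every `K`-root `r` of `f y` is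
  `u a y` for the unique old root `a` within `δ`; `a ↦ u a y` is injective on the old roots (★ P5 per root + ★ `exists_forall_root_near` «no new roots» +
  separation).
* `eventually_roots_toFinset_eq_image`: eventually `(f y).roots.toFinset = (f y₀).roots.toFinset.image (u · y)`.
HONEST LABEL: HC_CM is proved only modulo the 7 printed citations (2 remaining named inputs: hLiu418 = `stmt-HodgeConjecture-24832`, h413 =
`stmt-HodgeConjecture-24833`) until rung 0 closes; this file closes no organ (count-neutral datum-road brick).

## References
* [Gouvea1993PadicNumbers] F. Q. Gouvêa, *p-adic Numbers*, Universitext (1993∕1997), §6.8 (continuity of roots).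
* [Rogawski1990] J. D. Rogawski, *Automorphic Representations of Unitary Groups in Three Variables*, Ann. of Math. Stud. 123 (1990), §12.5 pp. 182–184.
-/

set_option autoImplicit false
-- the mandated namespace has the single-problem summit's repeated segment (`HodgeConjecture.HodgeConjecture`)
set_option linter.dupNamespace false

noncomputable section

open Polynomial Filter Topology Metric Set
open Summit.HodgeConjecture.HodgeConjecture.Cruxes.H413.F0P3cStCharTSRootCalculus (exists_forall_root_near)
open Summit.HodgeConjecture.HodgeConjecture.Cruxes.H413.F0P3cStCharTSRootCount (exists_pos_separating exists_pos_le_of_finset)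
open Summit.HodgeConjecture.HodgeConjecture.Cruxes.H413.F0P3cStCharTSMovingRoot
  (exists_continuousAt_root eventually_forall_norm_coeff_sub_lt eventually_norm_sub_lt_of_continuousAt)

namespace Summit.HodgeConjecture.HodgeConjecture.Cruxes.H413.F0P3cStCharTSMovingRootSystem

variable {K : Type*} [NormedField K] [ProperSpace K] {Y : Type*} [TopologicalSpace Y] {y₀ : Y}

/-- **The moving root system (MOVING-ROOT-SYSTEM★).**  `K` proper; `f : Y → K[X]` monic of constant degree near `y₀` with coefficients continuous at
`y₀`; every `K`-root of `f y₀` simple.  Then there are a window `δ > 0` separating the roots of `f y₀` and maps `u a : Y → K` with `u a y₀ = a` and `u a`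
continuous at `y₀` for each root `a` of `f y₀`, such that for all `y` near `y₀`: (i) each `u a y` is a root of `f y` within `δ` of `a`; (ii) every
`K`-root `r` of `f y` lies within `δ` of some old root `a` and equals `u a y`; (iii) `a ↦ u a y` is injective on the roots of `f y₀`. [folklore] -/
theorem exists_continuousAt_roots (f : Y → K[X]) (hmonic : ∀ᶠ y in 𝓝 y₀, (f y).Monic)
    (hdeg : ∀ᶠ y in 𝓝 y₀, (f y).natDegree = (f y₀).natDegree) (hcoeff : ∀ i, ContinuousAt (fun y => (f y).coeff i) y₀)
    (hsimple : ∀ a ∈ (f y₀).roots, (derivative (f y₀)).eval a ≠ 0) :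
    ∃ (δ : ℝ) (u : K → Y → K), 0 < δ ∧
      (∀ a ∈ (f y₀).roots, ∀ b ∈ (f y₀).roots, a ≠ b → 2 * δ ≤ ‖a - b‖) ∧
      (∀ a ∈ (f y₀).roots, u a y₀ = a ∧ ContinuousAt (u a) y₀) ∧
      ∀ᶠ y in 𝓝 y₀,
        (∀ a ∈ (f y₀).roots, (f y).IsRoot (u a y) ∧ ‖u a y - a‖ < δ) ∧
        (∀ r, (f y).IsRoot r → ∃ a ∈ (f y₀).roots, ‖r - a‖ < δ ∧ r = u a y) ∧
        (∀ a ∈ (f y₀).roots, ∀ b ∈ (f y₀).roots, u a y = u b y → a = b) := by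
  classical
  set p₀ := f y₀ with hp₀def
  have hp₀ : p₀.Monic := hmonic.self_of_nhds
  set S := p₀.roots.toFinset with hS
  have hmemS : ∀ a, a ∈ S ↔ a ∈ p₀.roots := fun a => Multiset.mem_toFinset
  set N := p₀.natDegree + 1 with hN
  have hdegN : ∀ᶠ y in 𝓝 y₀, (f y).natDegree < N := hdeg.mono fun y hy => by rw [hy]; exact Nat.lt_succ_self _
  -- (1) separation of the old roots
  obtain ⟨δ₁, hδ₁, hsep⟩ := exists_pos_separating S
  -- (2) one moving root per old root (★ P5), dummies off the root set
  have hone : ∀ a : K, ∃ (δ : ℝ) (u : Y → K), 0 < δ ∧ (a ∈ p₀.roots →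
      u y₀ = a ∧ ContinuousAt u y₀ ∧
        ∀ᶠ y in 𝓝 y₀, (f y).IsRoot (u y) ∧ ‖u y - a‖ < δ ∧ ∀ r, (f y).IsRoot r → ‖r - a‖ < δ → r = u y) := by
    intro a
    by_cases ha : a ∈ p₀.roots
    · obtain ⟨δ, u, hδ, hu0, huc, hev⟩ :=
        exists_continuousAt_root f hdegN hcoeff ((mem_roots hp₀.ne_zero).1 ha) (hsimple a ha)
      exact ⟨δ, u, hδ, fun _ => ⟨hu0, huc, hev⟩⟩
    · exact ⟨1, fun _ => a, one_pos, fun h => absurd h ha⟩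
  choose δa u hδa hu using hone
  obtain ⟨δ₂, hδ₂, hδ₂le⟩ := exists_pos_le_of_finset S δa fun a _ => hδa a
  set δ : ℝ := min δ₁ δ₂ with hδ
  have hδpos : 0 < δ := lt_min hδ₁ hδ₂
  have hδa' : ∀ a ∈ p₀.roots, δ ≤ δa a := fun a ha => le_trans (min_le_right _ _) (hδ₂le a ((hmemS a).2 ha))
  -- (3) «no new roots» radius for the window `δ` (★ `exists_forall_root_near`)
  obtain ⟨ε, hε, hold⟩ := exists_forall_root_near p₀ hp₀ hδpos
  refine ⟨δ, u, hδpos, fun a ha b hb hab => ?_, fun a ha => ⟨(hu a ha).1, (hu a ha).2.1⟩, ?_⟩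
  · exact le_trans (by linarith [min_le_left δ₁ δ₂]) (hsep a ((hmemS a).2 ha) b ((hmemS b).2 hb) hab)
  -- (4) the eventualities: per old root (finitely many), plus monic ∕ degree ∕ coefficients within `ε`
  have hper : ∀ᶠ y in 𝓝 y₀, ∀ a ∈ S, ((f y).IsRoot (u a y) ∧ ‖u a y - a‖ < δa a ∧
      (∀ r, (f y).IsRoot r → ‖r - a‖ < δa a → r = u a y)) ∧ ‖u a y - a‖ < δ := by
    rw [Filter.eventually_all_finset]
    intro a haS
    have ha : a ∈ p₀.roots := (hmemS a).1 haS
    exact ((hu a ha).2.2).and (eventually_norm_sub_lt_of_continuousAt (hu a ha).1 (hu a ha).2.1 hδpos)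
  filter_upwards [hper, hmonic, hdeg, eventually_forall_norm_coeff_sub_lt f hdegN hcoeff hε] with y hy hym hyd hyc
  refine ⟨fun a ha => ⟨(hy a ((hmemS a).2 ha)).1.1, (hy a ((hmemS a).2 ha)).2⟩, fun r hr => ?_, fun a ha b hb hab => ?_⟩
  · -- (ii) `r` is near some old root `a` (no new roots), hence `= u a y` (window uniqueness at `a`)
    obtain ⟨a, ha, hra⟩ := hold (f y) hym hyd hyc r hr
    exact ⟨a, ha, hra, (hy a ((hmemS a).2 ha)).1.2.2 r hr (lt_of_lt_of_le hra (hδa' a ha))⟩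
  · -- (iii) injectivity by separation
    by_contra hne
    have h2 := hsep a ((hmemS a).2 ha) b ((hmemS b).2 hb) hne
    have hua : ‖u a y - a‖ < δ := (hy a ((hmemS a).2 ha)).2
    have hub : ‖u b y - b‖ < δ := (hy b ((hmemS b).2 hb)).2
    rw [hab] at hua
    have h3 : ‖a - b‖ ≤ ‖u b y - a‖ + ‖u b y - b‖ := by
      calc ‖a - b‖ = ‖(u b y - b) - (u b y - a)‖ := by congr 1; ring
        _ ≤ ‖u b y - b‖ + ‖u b y - a‖ := norm_sub_le _ _
        _ = ‖u b y - a‖ + ‖u b y - b‖ := add_comm _ _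
    have h4 : δ ≤ δ₁ := min_le_left _ _
    linarith

/-- **Eventually the rational roots are exactly the moved old roots.**  With `δ, u` from `exists_continuousAt_roots`: for all `y` near `y₀`,
`(f y).roots.toFinset = (f y₀).roots.toFinset.image (fun a => u a y)` (and the image map is injective on the old roots). [folklore] -/
theorem eventually_roots_toFinset_eq_image [DecidableEq K] (f : Y → K[X]) (hmonic : ∀ᶠ y in 𝓝 y₀, (f y).Monic)
    (hdeg : ∀ᶠ y in 𝓝 y₀, (f y).natDegree = (f y₀).natDegree) (hcoeff : ∀ i, ContinuousAt (fun y => (f y).coeff i) y₀)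
    (hsimple : ∀ a ∈ (f y₀).roots, (derivative (f y₀)).eval a ≠ 0) :
    ∃ (δ : ℝ) (u : K → Y → K), 0 < δ ∧
      (∀ a ∈ (f y₀).roots, ∀ b ∈ (f y₀).roots, a ≠ b → 2 * δ ≤ ‖a - b‖) ∧
      (∀ a ∈ (f y₀).roots, u a y₀ = a ∧ ContinuousAt (u a) y₀) ∧
      ∀ᶠ y in 𝓝 y₀,
        (∀ a ∈ (f y₀).roots, (f y).IsRoot (u a y) ∧ ‖u a y - a‖ < δ) ∧
        (∀ a ∈ (f y₀).roots, ∀ b ∈ (f y₀).roots, u a y = u b y → a = b) ∧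
        (f y).roots.toFinset = (f y₀).roots.toFinset.image (fun a => u a y) := by
  obtain ⟨δ, u, hδ, hsep, hu0, hev⟩ := exists_continuousAt_roots f hmonic hdeg hcoeff hsimple
  refine ⟨δ, u, hδ, hsep, hu0, ?_⟩
  filter_upwards [hev, hmonic] with y hy hym
  obtain ⟨h1, h2, h3⟩ := hy
  refine ⟨h1, h3, ?_⟩
  ext r
  rw [Multiset.mem_toFinset, Finset.mem_image, mem_roots hym.ne_zero]
  constructor
  · intro hr
    obtain ⟨a, ha, -, hra⟩ := h2 r hr
    exact ⟨a, Multiset.mem_toFinset.2 ha, hra.symm⟩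
  · rintro ⟨a, ha, hra⟩
    rw [← hra]
    exact (h1 a (Multiset.mem_toFinset.1 ha)).1

end Summit.HodgeConjecture.HodgeConjecture.Cruxes.H413.F0P3cStCharTSMovingRootSystem

end
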